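import Summits.Ventures.Crystal3D.Theorems.StickyWulffConstantPolycrystalWulffBoundFreeEnergyExterior
import Summits.Ventures.Crystal3D.Theorems.StickyWulffConstantPolycrystalWulffBoundDichotomyArith
import Summits.Ventures.Crystal3D.Theorems.StickyWulffConstantPolycrystalWulffBoundSeparated
import Summits.Ventures.Crystal3D.Theses.StickyWulffConstant

/-!
# `PolycrystalWulffBound`, line `PolyDensity`: the FINE TWIN-FREE rung `rung_fineTwinFree` BY NAME

Route `StickyWulffConstant` of the venture `Summits/Ventures/Crystal3D`, crux `PolycrystalWulffBound`
(item `stmt-Ventures-19482`), second prover lane (poly-p2).  The planner's rung `rung_fineTwinFree`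
(cf-p1 g17 retype with pairwise distinct lattices, `HOME/cf-p1/route/lines/polydensity/PolyDensityRungsDefFree.lean`,
P-LINE §3), signature VERBATIM (the binders `f g` of `TF` are annotated `: Fin n`, same term, to keep
the unused-variable linter quiet), namespace `Summit.Ventures.Crystal3D.Cruxes.PolycrystalWulffBound.PolyDensity`:
a finite POLYHEDRAL texture that is twin-free (`TF`: co-axial frames carry the same lattice), whose
grains carry pairwise distinct lattices, and whose grains each carry at most `3/10` of the volume,
satisfies `6·2^{1/3}·(√2·Vol)^{2/3} ≤ En`.

Proof (the isoperimetric pincer of P-LINE §3): no pair is co-axial, so every wall is generic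
(`m = 0`, charge `c ≥ 1`, body `Dsc 0 = B̄(0,1)`); free part `≥ √3·Per(E)`
(`freeEnergy_ge_mul_perimeter`); wall part `≥ ½ Σ_{f≠g} ι_B(G f, G g) = ½(Σ_f Per(G f) − Per(E))`
(`sum_iota_eq_sum_per_sub_per`, `iota_nonneg_of_poly`); isoperimetry of `E` and of every grain
(`isoperimetric_toReal_three`); concavity/arithmetic `fine_pincer_arith` (gen 0).
WHAT THIS IS NOT: a registered stub of the skeleton (rungs are first targets, `--supports`); nothing on
textures with a grain above `3/10` of the volume or with twins; the crux is not claimed.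
-/

noncomputable section

open scoped BigOperators InnerProductSpace ENNReal
open MeasureTheory Filter

namespace Summit.Ventures.Crystal3D.Cruxes.PolycrystalWulffBound.PolyDensity

open Summit.Ventures.Crystal3D.Theorems
open Summit.Ventures.Crystal3D.Cruxes.TextureLiminf.TexShadow (per polytope E3)
open Literature.MathematicalPhysics.StatisticalMechanics (perimeter)

/-- **Rung `rung_fineTwinFree` (P-LINE §3, g17 retype), signature verbatim:** fine twin-free
polyhedral textures with pairwise distinct lattices satisfy the polycrystal Wulff bound
(isoperimetric pincer: free `≥ √3·Per(E)`, walls `≥ ½(Σ Per(G f) − Per(E))`, `fine_pincer_arith`). -/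
theorem rung_fineTwinFree :
    let Λ : Set (EuclideanSpace ℝ (Fin 3)) := Literature.MathematicalPhysics.StatisticalMechanics.fccStacking 1 (Real.sqrt (2 / 3));
    let Brl : (ℤ → ℤ) → Set (EuclideanSpace ℝ (Fin 3)) := Literature.MathematicalPhysics.StatisticalMechanics.barlowStacking 1 (Real.sqrt (2 / 3));
    let Ax : EuclideanSpace ℝ (Fin 3) → (EuclideanSpace ℝ (Fin 3) ≃ₗᵢ[ℝ] EuclideanSpace ℝ (Fin 3)) → (EuclideanSpace ℝ (Fin 3) ≃ₗᵢ[ℝ] EuclideanSpace ℝ (Fin 3)) → Prop := fun m A B => ∃ (L : EuclideanSpace ℝ (Fin 3) ≃ₗᵢ[ℝ] EuclideanSpace ℝ (Fin 3)) (s₁ s₂ : EuclideanSpace ℝ (Fin 3)) (σ σ' : ℤ → ℤ), Literature.MathematicalPhysics.StatisticalMechanics.IsHaggSeq σ ∧ Literature.MathematicalPhysics.StatisticalMechanics.IsHaggSeq σ' ∧ L (EuclideanSpace.single (2 : Fin 3) (1 : ℝ)) = m ∧ A '' Λ ⊆ (fun q => L q + s₁) '' Brl σ ∧ B '' Λ ⊆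 (fun q => L q + s₂) '' Brl σ';
    let CoAx : (EuclideanSpace ℝ (Fin 3) ≃ₗᵢ[ℝ] EuclideanSpace ℝ (Fin 3)) → (EuclideanSpace ℝ (Fin 3) ≃ₗᵢ[ℝ] EuclideanSpace ℝ (Fin 3)) → Prop := fun A B => ∃ m, Ax m A B;
    let Φ : EuclideanSpace ℝ (Fin 3) → ℝ := fun ν => Real.sqrt 2 / 4 * ∑ᶠ w ∈ {w ∈ Λ | ‖w‖ = 1}, |⟪w, ν⟫_ℝ|;
    let Per : Set (EuclideanSpace ℝ (Fin 3)) → Set (EuclideanSpace ℝ (Fin 3)) → ℝ := fun K S => (⨆ (ξ : EuclideanSpace ℝ (Fin 3) → EuclideanSpace ℝ (Fin 3)) (_ : ContDiff ℝ 1 ξ ∧ HasCompactSupport ξ ∧ ∀ z, ξ z ∈ K), ENNReal.ofReal (∫ z in S, Literature.MathematicalPhysics.StatisticalMechanics.fieldDivergence ξ z)).toReal;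
    let ι : Set (EuclideanSpace ℝ (Fin 3)) → Set (EuclideanSpace ℝ (Fin 3)) → Set (EuclideanSpace ℝ (Fin 3)) → ℝ := fun K S₁ S₂ => (Per K S₁ + Per K S₂ - Per K (S₁ ∪ S₂)) / 2;
    let W : (EuclideanSpace ℝ (Fin 3) ≃ₗᵢ[ℝ] EuclideanSpace ℝ (Fin 3)) → Set (EuclideanSpace ℝ (Fin 3)) := fun A => {y | ∀ ν : EuclideanSpace ℝ (Fin 3), ⟪y, ν⟫_ℝ ≤ Φ (A.symm ν)};
    let Dsc : EuclideanSpace ℝ (Fin 3) → Set (EuclideanSpace ℝ (Fin 3)) := fun m => {y | ‖y‖ ≤ 1 ∧ ⟪y, m⟫_ℝ = 0};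
    let Tex : (n : ℕ) → (Fin n → Set (EuclideanSpace ℝ (Fin 3))) → (Fin n → (EuclideanSpace ℝ (Fin 3) ≃ₗᵢ[ℝ] EuclideanSpace ℝ (Fin 3))) → (Fin n → Fin n → ℝ) → (Fin n → Fin n → EuclideanSpace ℝ (Fin 3)) → Prop := fun n G A c m => (∀ f : Fin n, Literature.MathematicalPhysics.StatisticalMechanics.HasFinitePerimeter (G f) ∧ volume (G f) < ⊤) ∧ (∀ f g, f ≠ g → Disjoint (G f) (G g)) ∧ (∀ f g, f ≠ g → 0 ≤ c f g) ∧ (∀ f g, f ≠ g → ¬ CoAx (A f) (A g) → m f g = 0 ∧ 1 ≤ c f g) ∧ (∀ f g, f ≠ g → CoAx (A f) (A g) → A f '' Λ ≠ A g '' Λ → Ax (m f g) (A f) (A g) ∧ 1 / 2 ≤ c f g);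
    let En : (n : ℕ) → (Fin n → Set (EuclideanSpace ℝ (Fin 3))) → (Fin n → (EuclideanSpace ℝ (Fin 3) ≃ₗᵢ[ℝ] EuclideanSpace ℝ (Fin 3))) → (Fin n → Fin n → ℝ) → (Fin n → Fin n → EuclideanSpace ℝ (Fin 3)) → ℝ := fun n G A c m => ∑ f : Fin n, Per (W (A f)) (G f) - ∑ f, ∑ g, (if f = g then 0 else ι (W (A f)) (G f) (G g)) + ∑ f, ∑ g, (if f = g then 0 else c f g / 2 * ι (Dsc (m f g)) (G f) (G g));
    let Vol : (n : ℕ) → (Fin n → Set (EuclideanSpace ℝ (Fin 3))) → ℝ := fun n G => (volume (⋃ f : Fin n, G f)).toReal;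
    let Poly : Set (EuclideanSpace ℝ (Fin 3)) → Prop := fun S => ∃ (k : ℕ) (H : Fin k → Finset ((EuclideanSpace ℝ (Fin 3)) × ℝ)), S = ⋃ i, ⋂ p ∈ H i, {x | ⟪p.1, x⟫_ℝ < p.2};
    let TF : (n : ℕ) → (Fin n → (EuclideanSpace ℝ (Fin 3) ≃ₗᵢ[ℝ] EuclideanSpace ℝ (Fin 3))) → Prop := fun n A => ∀ f g : Fin n, f ≠ g → CoAx (A f) (A g) → A f '' Λ = A g '' Λ;
    ∀ (n : ℕ) (G : Fin n → Set (EuclideanSpace ℝ (Fin 3))) (A : Fin n → (EuclideanSpace ℝ (Fin 3) ≃ₗᵢ[ℝ] EuclideanSpace ℝ (Fin 3))) (c : Fin n → Fin n → ℝ) (m : Fin n → Fin n → EuclideanSpace ℝ (Fin 3)), Tex n G A c m → (∀ f, Poly (G f)) → TF n A → (∀ f g, f ≠ g → A f '' Λ ≠ A g '' Λ) → (∀ f, (volume (G f)).toReal ≤ 3 / 10 * Vol n G) → 6 * (2 : ℝ) ^ ((1 : ℝ) / 3) * (Real.sqrt 2 * Vol n G) ^ ((2 : ℝ) / 3) ≤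 En n G A c m  := by
  intro Λ Brl Ax CoAx Φ Per ι W Dsc Tex En Vol Poly TF n G A c m hTex hPoly hTF hlat hsmall
  obtain ⟨hfin, hdisj, -, hgen, -⟩ := hTex
  have hvol : ∀ f, volume (G f) < ⊤ := fun f => (hfin f).2
  obtain ⟨hEm, hEv, hEp, hVsum⟩ := texture_union_facts G hfin hdisj
  -- no pair is co-axial: every wall is generic (`m = 0`, charge `≥ 1`)
  have hwall : ∀ f g, f ≠ g → m f g = 0 ∧ 1 ≤ c f g := fun f g hfg =>
    hgen f g hfg (fun hco => hlat f g hfg (hTF f g hfg hco))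
  -- the generic wall body is the closed unit ball
  have hDsc0 : Dsc 0 = Metric.closedBall (0 : E3) 1 := by
    show {y : E3 | ‖y‖ ≤ 1 ∧ ⟪y, (0 : E3)⟫_ℝ = 0} = Metric.closedBall 0 1
    ext y
    simp [inner_zero_right]
  have hBc : IsCompact (Metric.closedBall (0 : E3) 1) := isCompact_closedBall 0 1
  have hBv : Convex ℝ (Metric.closedBall (0 : E3) 1) := convex_closedBall 0 1
  have hB0 : (0 : E3) ∈ Metric.closedBall (0 : E3) 1 := Metric.mem_closedBall_self zero_le_one
  have hBs : -Metric.closedBall (0 : E3) 1 = Metric.closedBall 0 1 := by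
    rw [neg_closedBall, neg_zero]
  -- the free energy dominates `√3 · Per(E)`
  have hFr : Real.sqrt 3 * (perimeter (⋃ f, G f)).toReal ≤
      ∑ f, (Per (W (A f)) (G f) - ∑ g, (if f = g then 0 else ι (W (A f)) (G f) (G g))) :=
    freeEnergy_ge_mul_perimeter G hPoly hvol hdisj (fun f => W (A f))
      (fun f => isCompact_cruxWulffBody (A f)) (fun f => convex_cruxWulffBody (A f))
      (fun f => zero_mem_cruxWulffBody (A f)) (fun f => neg_cruxWulffBody_eq (A f))
      (Real.sqrt_pos.2 (by norm_num)) (fun f => closedBall_subset_cruxWulffBody (A f))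
  -- the wall energy dominates `½ (Σ_f Per(G f) − Per(E))`
  have hιB : (∑ f, ∑ g, (if f = g then 0 else
      (per (Metric.closedBall (0 : E3) 1) (G f) + per (Metric.closedBall (0 : E3) 1) (G g) -
        per (Metric.closedBall (0 : E3) 1) (G f ∪ G g)) / 2)) =
      (∑ f, per (Metric.closedBall (0 : E3) 1) (G f)) - per (Metric.closedBall (0 : E3) 1) (⋃ f, G f) :=
    sum_iota_eq_sum_per_sub_per G hPoly hvol hdisj hBc hBv hB0 hBs
  have hperB : ∀ S : Set E3, per (Metric.closedBall (0 : E3) 1) S = (perimeter S).toReal := fun S => by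
    rw [per_closedBall_eq_mul_perimeter one_pos S, one_mul]
  have hterm : ∀ f g, (if f = g then 0 else
      (per (Metric.closedBall (0 : E3) 1) (G f) + per (Metric.closedBall (0 : E3) 1) (G g) -
        per (Metric.closedBall (0 : E3) 1) (G f ∪ G g)) / 2) ≤
      2 * (if f = g then 0 else c f g / 2 * ι (Dsc (m f g)) (G f) (G g)) := by
    intro f g
    by_cases hfg : f = g
    · rw [if_pos hfg, if_pos hfg, mul_zero]
    · rw [if_neg hfg, if_neg hfg]
      obtain ⟨hm, hc⟩ := hwall f g hfg
      rw [hm, hDsc0]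
      have hnn := iota_nonneg_of_poly G hPoly hvol hdisj hBc hBv hB0 hfg
      show (per (Metric.closedBall (0 : E3) 1) (G f) + per (Metric.closedBall (0 : E3) 1) (G g) -
          per (Metric.closedBall (0 : E3) 1) (G f ∪ G g)) / 2 ≤
        2 * (c f g / 2 * ((per (Metric.closedBall (0 : E3) 1) (G f) +
          per (Metric.closedBall (0 : E3) 1) (G g) - per (Metric.closedBall (0 : E3) 1) (G f ∪ G g)) / 2))
      nlinarith
  have hbook : (∑ f, (perimeter (G f)).toReal) ≤ (perimeter (⋃ f, G f)).toReal +
      2 * ∑ f, ∑ g, (if f = g then 0 else c f g / 2 * ι (Dsc (m f g)) (G f) (G g)) := by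
    have hsum : (∑ f, ∑ g, (if f = g then 0 else
        (per (Metric.closedBall (0 : E3) 1) (G f) + per (Metric.closedBall (0 : E3) 1) (G g) -
          per (Metric.closedBall (0 : E3) 1) (G f ∪ G g)) / 2)) ≤
        ∑ f, ∑ g, 2 * (if f = g then 0 else c f g / 2 * ι (Dsc (m f g)) (G f) (G g)) :=
      Finset.sum_le_sum fun f _ => Finset.sum_le_sum fun g _ => hterm f g
    rw [hιB] at hsum
    simp_rw [← Finset.mul_sum] at hsum
    rw [hperB, Finset.sum_congr rfl fun f _ => hperB (G f)] at hsum
    linarith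
  -- isoperimetry of the union and of every grain, and the pincer arithmetic
  have hiso := isoperimetric_toReal_three hEm hEv hEp
  have hisoG : ∀ f ∈ (Finset.univ : Finset (Fin n)), 3 * (Real.pi * 4 / 3) ^ ((1 : ℝ) / 3) *
      (volume (G f)).toReal ^ ((2 : ℝ) / 3) ≤ (perimeter (G f)).toReal := fun f _ =>
    isoperimetric_toReal_three (hfin f).1.1 (hfin f).2 (hfin f).1.2.ne
  have harith := fine_pincer_arith (Finset.univ : Finset (Fin n)) isoConst_three_pos
    (le_of_eq isoConst_three_cube.symm) hVsum (fun f _ => ENNReal.toReal_nonneg)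
    (fun f _ => hsmall f) hiso hisoG hbook
  have hEn : En n G A c m =
      (∑ f, (Per (W (A f)) (G f) - ∑ g, (if f = g then 0 else ι (W (A f)) (G f) (G g)))) +
        ∑ f, ∑ g, (if f = g then 0 else c f g / 2 * ι (Dsc (m f g)) (G f) (G g)) := by
    show (∑ f, Per (W (A f)) (G f) -
        ∑ f, ∑ g, (if f = g then 0 else ι (W (A f)) (G f) (G g)) +
        ∑ f, ∑ g, (if f = g then 0 else c f g / 2 * ι (Dsc (m f g)) (G f) (G g))) =
      (∑ f, (Per (W (A f)) (G f) - ∑ g, (if f = g then 0 else ι (W (A f)) (G f) (G g)))) +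
        ∑ f, ∑ g, (if f = g then 0 else c f g / 2 * ι (Dsc (m f g)) (G f) (G g))
    rw [Finset.sum_sub_distrib]
  rw [hEn]
  exact harith.trans (by linarith)

end Summit.Ventures.Crystal3D.Cruxes.PolycrystalWulffBound.PolyDensity

end
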